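import Literature.Geometry.Riemannian.MeanConvexPlanarCalculus
import Mathlib.Analysis.SpecialFunctions.Trigonometric.ArctanDeriv

/-!
# The two model zones of the planar junction profile: partial derivatives and the flat frame sum

Topic `Geometry/Riemannian` (fact seat
`provefact-Literature.Geometry.Riemannian.LawsonMichelsohn1984_surrounding`).  Everything here
is **proved**; no definitions.

The planar profile `Φ` of the junction (Lawson–Michelsohn §3, the bending of `Σ` into the tube
around the handle core) coincides near each of its zeros with one of two model functions of
`(r, t)`: the **graph profile** `t - τ(r)` with `τ' = -tan θ` (`θ` the angle profile of
`MeanConvexProfile.exists_angleProfile`), and the **chimney profile** `c (r - ρ(t))` (`ρ` the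
bend of `MeanConvexProfile.exists_chimneyBend`, `c = tan θ₁`).  For both this file lists the
six partial derivatives `Φ_r, Φ_t, Φ_rr, Φ_rt, Φ_tr, Φ_tt` (as Fréchet derivatives on `ℝ × ℝ`,
the form consumed by `MeanConvexFlatFrameSum.frameSum_biradial` and
`MeanConvexFramePerturbation.abs_scalarFrameSum_sub_flat_le`) and evaluates the flat frame sum
`Q_k(Φ) = (Φ_rr Φ_t² - (Φ_rt + Φ_tr) Φ_r Φ_t + Φ_tt Φ_r²)/(Φ_r² + Φ_t²) + (k-1) Φ_r / r`:

* `graphProfile_derivs`, `frameSumQ_graphProfile` — `Φ_r = tan θ`, `Φ_t = 1`,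
  `Φ_rr = θ'/cos² θ`, the others `0`; `Q = θ' + (k-1) tan θ / r`;
* `chimneyProfile_derivs`, `frameSumQ_chimneyProfile` — `Φ_r = c`, `Φ_t = -c ρ'`, `Φ_tt = -c ρ''`,
  the others `0`; `Q = c ((k-1)/r - ρ''/(1 + ρ'²))`.

## References

* H. B. Lawson, Jr., M.-L. Michelsohn, *Embedding and surrounding with positive mean curvature*,
  Invent. Math. 77 (1984), §3. [LawsonMichelsohn1984]
-/

noncomputable section

open Set Function Filter
open scoped Topology

namespace Literature.Geometry.Riemannian

/-! ### The graph profile -/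

section Graph

variable {θ τ : ℝ → ℝ} {r t θ' : ℝ}

/-- The second derivative of the height function: `τ'' = -θ'/cos² θ` when `τ' = -tan θ` near
`r`. [folklore] -/
theorem hasDerivAt_deriv_heightFun (hτ : ∀ᶠ s in 𝓝 r, HasDerivAt τ (-Real.tan (θ s)) s)
    (hθ : HasDerivAt θ θ' r) (hcos : Real.cos (θ r) ≠ 0) :
    HasDerivAt (deriv τ) (-(1 / Real.cos (θ r) ^ 2 * θ')) r := by
  have hτ'ev : deriv τ =ᶠ[𝓝 r] fun s => -Real.tan (θ s) := hτ.mono fun s hs => hs.deriv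
  have htan : HasDerivAt (fun s => -Real.tan (θ s)) (-(1 / Real.cos (θ r) ^ 2 * θ')) r :=
    ((Real.hasDerivAt_tan hcos).comp r hθ).neg
  exact htan.congr_of_eventuallyEq hτ'ev

/-- **Partial derivatives of the graph profile** `Φ(r, t) = t - τ(r)`, `τ' = -tan θ`:
`Φ_r = tan θ(r)`, `Φ_t = 1`, `Φ_rr = θ'(r)/cos² θ(r)`, `Φ_rt = Φ_tr = Φ_tt = 0`. [folklore] -/
theorem graphProfile_derivs (hτ : ∀ᶠ s in 𝓝 r, HasDerivAt τ (-Real.tan (θ s)) s)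
    (hθ : HasDerivAt θ θ' r) (hcos : Real.cos (θ r) ≠ 0) :
    fderiv ℝ (fun p : ℝ × ℝ => p.2 - τ p.1) (r, t) (1, 0) = Real.tan (θ r) ∧
    fderiv ℝ (fun p : ℝ × ℝ => p.2 - τ p.1) (r, t) (0, 1) = 1 ∧
    fderiv ℝ (fderiv ℝ (fun p : ℝ × ℝ => p.2 - τ p.1)) (r, t) (1, 0) (1, 0) =
      θ' / Real.cos (θ r) ^ 2 ∧
    fderiv ℝ (fderiv ℝ (fun p : ℝ × ℝ => p.2 - τ p.1)) (r, t) (1, 0) (0, 1) = 0 ∧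
    fderiv ℝ (fderiv ℝ (fun p : ℝ × ℝ => p.2 - τ p.1)) (r, t) (0, 1) (1, 0) = 0 ∧
    fderiv ℝ (fderiv ℝ (fun p : ℝ × ℝ => p.2 - τ p.1)) (r, t) (0, 1) (0, 1) = 0 := by
  have hτr : HasDerivAt τ (-Real.tan (θ r)) r := hτ.self_of_nhds
  have hdiff : ∀ᶠ s in 𝓝 r, DifferentiableAt ℝ τ s := hτ.mono fun s hs => hs.differentiableAt
  have h2 := hasDerivAt_deriv_heightFun hτ hθ hcos
  refine ⟨?_, ?_, ?_, ?_, ?_, ?_⟩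
  · rw [fderiv_graphProfile_apply τ hτr]; ring
  · rw [fderiv_graphProfile_apply τ hτr]; ring
  · rw [fderiv_fderiv_graphProfile_apply τ hdiff h2]; field_simp
  · rw [fderiv_fderiv_graphProfile_apply τ hdiff h2]; ring
  · rw [fderiv_fderiv_graphProfile_apply τ hdiff h2]; ring
  · rw [fderiv_fderiv_graphProfile_apply τ hdiff h2]; ring

/-- **The flat frame sum of the graph profile**: `Q_k = θ' + (k-1) tan θ / r`
(`= (cos θ θ' + (k-1) sin θ / r)/cos θ`, cf. `MeanConvexProfile.frameSum_graph_eq_of_angle`).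
[folklore] -/
theorem frameSumQ_graphProfile (hτ : ∀ᶠ s in 𝓝 r, HasDerivAt τ (-Real.tan (θ s)) s)
    (hθ : HasDerivAt θ θ' r) (hcos : Real.cos (θ r) ≠ 0) (κ : ℝ) :
    (fderiv ℝ (fderiv ℝ (fun p : ℝ × ℝ => p.2 - τ p.1)) (r, t) (1, 0) (1, 0) *
            fderiv ℝ (fun p : ℝ × ℝ => p.2 - τ p.1) (r, t) (0, 1) ^ 2 -
          (fderiv ℝ (fderiv ℝ (fun p : ℝ × ℝ => p.2 - τ p.1)) (r, t) (1, 0) (0, 1) +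
              fderiv ℝ (fderiv ℝ (fun p : ℝ × ℝ => p.2 - τ p.1)) (r, t) (0, 1) (1, 0)) *
            fderiv ℝ (fun p : ℝ × ℝ => p.2 - τ p.1) (r, t) (1, 0) *
            fderiv ℝ (fun p : ℝ × ℝ => p.2 - τ p.1) (r, t) (0, 1) +
        fderiv ℝ (fderiv ℝ (fun p : ℝ × ℝ => p.2 - τ p.1)) (r, t) (0, 1) (0, 1) *
          fderiv ℝ (fun p : ℝ × ℝ => p.2 - τ p.1) (r, t) (1, 0) ^ 2) /
        (fderiv ℝ (fun p : ℝ × ℝ => p.2 - τ p.1) (r, t) (1, 0) ^ 2 +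
          fderiv ℝ (fun p : ℝ × ℝ => p.2 - τ p.1) (r, t) (0, 1) ^ 2) +
      κ * fderiv ℝ (fun p : ℝ × ℝ => p.2 - τ p.1) (r, t) (1, 0) / r =
      θ' + κ * Real.tan (θ r) / r := by
  obtain ⟨h1, h2, h3, h4, h5, h6⟩ := graphProfile_derivs (t := t) hτ hθ hcos
  rw [h1, h2, h3, h4, h5, h6]
  have htan : 1 + Real.tan (θ r) ^ 2 = 1 / Real.cos (θ r) ^ 2 := by
    rw [Real.tan_eq_sin_div_cos, div_pow]
    have := Real.sin_sq_add_cos_sq (θ r)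
    field_simp
    linarith
  have hc2 : Real.cos (θ r) ^ 2 ≠ 0 := pow_ne_zero 2 hcos
  have e : (θ' / Real.cos (θ r) ^ 2 * 1 ^ 2 - (0 + 0) * Real.tan (θ r) * 1 + 0 * Real.tan (θ r) ^ 2) /
      (Real.tan (θ r) ^ 2 + 1 ^ 2) = θ' := by
    rw [show Real.tan (θ r) ^ 2 + 1 ^ 2 = 1 + Real.tan (θ r) ^ 2 by ring, htan]
    field_simp
    ring
  rw [e]

end Graph

/-! ### The chimney profile -/

section Chimney

variable {ρ : ℝ → ℝ} {r t : ℝ} (c : ℝ)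

/-- **Partial derivatives of the chimney profile** `Φ(r, t) = c (r - ρ(t))`:
`Φ_r = c`, `Φ_t = -c ρ'(t)`, `Φ_tt = -c ρ''(t)`, `Φ_rr = Φ_rt = Φ_tr = 0`. [folklore] -/
theorem chimneyProfile_derivs (hρ : ∀ s, HasDerivAt ρ (deriv ρ s) s)
    (hρ2 : HasDerivAt (deriv ρ) (deriv (deriv ρ) t) t) :
    fderiv ℝ (fun p : ℝ × ℝ => c * (p.1 - ρ p.2)) (r, t) (1, 0) = c ∧
    fderiv ℝ (fun p : ℝ × ℝ => c * (p.1 - ρ p.2)) (r, t) (0, 1) = -(c * deriv ρ t) ∧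
    fderiv ℝ (fderiv ℝ (fun p : ℝ × ℝ => c * (p.1 - ρ p.2))) (r, t) (1, 0) (1, 0) = 0 ∧
    fderiv ℝ (fderiv ℝ (fun p : ℝ × ℝ => c * (p.1 - ρ p.2))) (r, t) (1, 0) (0, 1) = 0 ∧
    fderiv ℝ (fderiv ℝ (fun p : ℝ × ℝ => c * (p.1 - ρ p.2))) (r, t) (0, 1) (1, 0) = 0 ∧
    fderiv ℝ (fderiv ℝ (fun p : ℝ × ℝ => c * (p.1 - ρ p.2))) (r, t) (0, 1) (0, 1) =
      -(c * deriv (deriv ρ) t) := by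
  have hdiff : ∀ᶠ s in 𝓝 t, DifferentiableAt ℝ ρ s :=
    Eventually.of_forall fun s => (hρ s).differentiableAt
  refine ⟨?_, ?_, ?_, ?_, ?_, ?_⟩
  · rw [fderiv_chimneyProfile_apply ρ c (hρ t)]; ring
  · rw [fderiv_chimneyProfile_apply ρ c (hρ t)]; ring
  · rw [fderiv_fderiv_chimneyProfile_apply ρ c hdiff hρ2]; ring
  · rw [fderiv_fderiv_chimneyProfile_apply ρ c hdiff hρ2]; ring
  · rw [fderiv_fderiv_chimneyProfile_apply ρ c hdiff hρ2]; ring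
  · rw [fderiv_fderiv_chimneyProfile_apply ρ c hdiff hρ2]; ring

/-- **The flat frame sum of the chimney profile**: `Q_k = c ((k-1)/r - ρ''/(1 + ρ'²))` for
`c ≠ 0` (cf. `MeanConvexProfile.frameSum_chimney_pos`). [folklore] -/
theorem frameSumQ_chimneyProfile (hc : c ≠ 0) (hρ : ∀ s, HasDerivAt ρ (deriv ρ s) s)
    (hρ2 : HasDerivAt (deriv ρ) (deriv (deriv ρ) t) t) (κ : ℝ) :
    (fderiv ℝ (fderiv ℝ (fun p : ℝ × ℝ => c * (p.1 - ρ p.2))) (r, t) (1, 0) (1, 0) *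
            fderiv ℝ (fun p : ℝ × ℝ => c * (p.1 - ρ p.2)) (r, t) (0, 1) ^ 2 -
          (fderiv ℝ (fderiv ℝ (fun p : ℝ × ℝ => c * (p.1 - ρ p.2))) (r, t) (1, 0) (0, 1) +
              fderiv ℝ (fderiv ℝ (fun p : ℝ × ℝ => c * (p.1 - ρ p.2))) (r, t) (0, 1) (1, 0)) *
            fderiv ℝ (fun p : ℝ × ℝ => c * (p.1 - ρ p.2)) (r, t) (1, 0) *
            fderiv ℝ (fun p : ℝ × ℝ => c * (p.1 - ρ p.2)) (r, t) (0, 1) +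
        fderiv ℝ (fderiv ℝ (fun p : ℝ × ℝ => c * (p.1 - ρ p.2))) (r, t) (0, 1) (0, 1) *
          fderiv ℝ (fun p : ℝ × ℝ => c * (p.1 - ρ p.2)) (r, t) (1, 0) ^ 2) /
        (fderiv ℝ (fun p : ℝ × ℝ => c * (p.1 - ρ p.2)) (r, t) (1, 0) ^ 2 +
          fderiv ℝ (fun p : ℝ × ℝ => c * (p.1 - ρ p.2)) (r, t) (0, 1) ^ 2) +
      κ * fderiv ℝ (fun p : ℝ × ℝ => c * (p.1 - ρ p.2)) (r, t) (1, 0) / r =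
      c * (κ / r - deriv (deriv ρ) t / (1 + deriv ρ t ^ 2)) := by
  obtain ⟨h1, h2, h3, h4, h5, h6⟩ := chimneyProfile_derivs (r := r) c hρ hρ2
  rw [h1, h2, h3, h4, h5, h6]
  have hc2 : c ^ 2 ≠ 0 := pow_ne_zero 2 hc
  have hd : c ^ 2 + (-(c * deriv ρ t)) ^ 2 = c ^ 2 * (1 + deriv ρ t ^ 2) := by ring
  have h1' : (1 : ℝ) + deriv ρ t ^ 2 ≠ 0 := by positivity
  rw [hd]
  field_simp
  ring

end Chimney

end Literature.Geometry.Riemannian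

end
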